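import Summits.NavierStokesRegularity.NavierStokesRegularity.Theorems.SqueezeCycleSingularProfileOfNontrivialTypeIBound
import Literature.Analysis.FluidPDE.SlabTypeICompactness
import Summits.NavierStokesRegularity.NavierStokesRegularity.Theses.SqueezeCycle
import Summits.NavierStokesRegularity.NavierStokesRegularity.Theorems.SqueezeCycleExtremalBiaxialitySubcriticalOfLiouville
import Summits.NavierStokesRegularity.NavierStokesRegularity.Theorems.AdaptedFrequencyTangentFlowTransferAncientPressure
import Summits.NavierStokesRegularity.NavierStokesRegularity.Theorems.ApexLocalisation.Negative.BridgeBlowDown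
import Summits.NavierStokesRegularity.NavierStokesRegularity.Theorems.ApexLocalisation.Negative.BridgeVacuity

/-!
# Route SqueezeCycle · item `SingularProfileOfNontrivial` (stmt-NavierStokesRegularity-15368):
# the bridge 𝒦_C → Albritton–Barker's class: PROOF of the item

`singularProfileOfNontrivial_proof : SqueezeCycle.SingularProfileOfNontrivial` (Albritton–Barker 2019,
Thm 1.1, REVERSE direction, run inside 𝒦_C). A member `u` of 𝒦_C not identically zero on `t < 0` is
classical on `(−∞,0)` for one pressure (`exists_isClassicalNSSolutionOn_Iio_of_isTypeIAncientMild`), hence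
a suitable weak slab solution with weak gradient `∇u`, and `𝐈(ℝ³ × ℝ₋) < ∞` (`typeIBound_slab_lt_top`,
the work of the helper files `…MorreySlice / MorreyPotential / ProbeBounds / MorreyDuality /
PressureIdentification / PressureOscillation / ModelClass / UnitBallEnergy / TypeIBound`). Its blow-downs
`c u(c²t, cx)`, `c → ∞`, obey the same rate, are not a.e. zero, and blow up in `L^∞(Q(0,R))` for every
`R`, so the tree's engine `slab_typeI_compactness` (A–B Lemma 2.2 + Prop 2.3 on the slab) gives an
origin-singular suitable weak slab solution with `𝐈 < ∞` and the rate a.e. (`blowDown_of_slabEngine`), made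
pointwise by `exists_rate_profile_repr` — verbatim the hypotheses of `RecurrentProfiles.RecurrentReduction`.

References: T. Tao, Anal. PDE 6 (2013), §4, proof of Lemma 4.1 (i) [Tao2011]; D. Albritton, T. Barker,
J. Math. Fluid Mech. 21 (2019) = arXiv:1811.00502, §1, §3 [AlbrittonBarker2019]; G. Koch, N. Nadirashvili,
G. Seregin, V. Šverák, Acta Math. 203 (2009) [KochNadirashviliSereginSverak2009].
-/

noncomputable section

-- the sub-problem namespace repeats the summit name (D-0017 layout `Summit.<S>.<P>.Theorems`)
set_option linter.dupNamespace false
-- nested operator types `ℝ³ →L[ℝ] ℝ³ →L[ℝ] ℝ³ →L[ℝ] ℝ` (pressure kernels)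
set_option maxSynthPendingDepth 3

namespace Summit.NavierStokesRegularity.NavierStokesRegularity.Theorems

open MeasureTheory Set Filter Metric Function
open _root_.Topology
open scoped ENNReal NNReal Laplacian ContDiff RealInnerProductSpace
open Literature.Analysis.FluidPDE
open Literature.Analysis.FluidPDE.FourierNS (HasDecay)
open Summit.NavierStokesRegularity.NavierStokesRegularity.Theorems.SingularProfile

/-- **A class member with a classical pressure is an Albritton–Barker slab profile with
`𝐈 < ∞`**: suitable weak on the slab (classical ⇒ suitable, CKN 1982 §2), weak gradient
`fderiv`, and `typeIBound_slab_lt_top`. [cite: AlbrittonBarker2019, §1] -/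
theorem squeezeCycle_slabProfile_of_modelClass {C : ℝ} {u : ℝ → (EuclideanSpace ℝ (Fin 3)) → (EuclideanSpace ℝ (Fin 3))}
    {q : ℝ → (EuclideanSpace ℝ (Fin 3)) → ℝ} (hK : IsTypeIAncientMild C u)
    (h5 : ∀ (x₀ : EuclideanSpace ℝ (Fin 3)) (t₀ r : ℝ), t₀ ≤ 0 → 0 < r →
      (∀ t, t₀ - r ^ 2 < t → t < t₀ → r⁻¹ * ∫ x in ball x₀ r, ‖u t x‖ ^ 2 ≤ C) ∧
        r⁻¹ * ∫ t in Ioo (t₀ - r ^ 2) t₀, ∫ x in ball x₀ r, ‖fderiv ℝ (u t) x‖ ^ 2 ≤ C)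
    (hq : IsClassicalNSSolutionOn (Iio 0) 1 0 u q) :
    IsSuitableWeakSolutionOn (slab (EuclideanSpace ℝ (Fin 3)) (Iio 0) isOpen_Iio) 1 0 u q ∧
    HasWeakSpatialGradientOn (slab (EuclideanSpace ℝ (Fin 3)) (Iio 0) isOpen_Iio) u
      (fun t x => fderiv ℝ (u t) x) ∧
    typeIBound (Iio (0 : ℝ) ×ˢ univ) u q (fun t x => fderiv ℝ (u t) x) < ⊤ := by
  have hQ : ((slab (EuclideanSpace ℝ (Fin 3)) (Iio 0) isOpen_Iio :
      TopologicalSpace.Opens (ℝ × EuclideanSpace ℝ (Fin 3))) : Set (ℝ × EuclideanSpace ℝ (Fin 3))) ⊆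
      Iio (0 : ℝ) ×ˢ univ := by
    rw [coe_slab]
  refine ⟨?_, ?_, typeIBound_slab_lt_top hK h5 hq⟩
  · refine isSuitableWeakSolutionOn_of_contDiffOn isOpen_Iio hQ
      (hq.smooth_velocity.of_le (by norm_cast)) (hq.smooth_pressure.of_le (by norm_cast))
      continuousOn_const (fun t ht x => ?_) hq.divFree
    have hm := hq.momentum t ht x
    rwa [timeDerivWithin_apply, derivWithin_of_isOpen isOpen_Iio ht, ← timeDeriv_apply] at hm
  · exact hasWeakSpatialGradientOn_of_contDiffOn isOpen_Iio hQ (hK.contDiffOn.of_le (by norm_cast))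

/-- **Item `SingularProfileOfNontrivial` (stmt-NavierStokesRegularity-15368) holds** — the BRIDGE
𝒦_C → Albritton–Barker's local-energy class (Albritton–Barker 2019, Thm 1.1, reverse direction,
run inside 𝒦_C). A member `u` of 𝒦_C that is not identically zero on `t < 0` is classical on
`(−∞,0)` for one pressure `q` (`exists_isClassicalNSSolutionOn_Iio_of_isTypeIAncientMild`),
hence a suitable weak slab profile with weak gradient `∇u` and — the work of this file's
helpers — `𝐈(ℝ³ × ℝ₋) < ∞` (`squeezeCycle_slabProfile_of_modelClass`: the pressure is the Riesz pressure up to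
a function of time by Tao's probe argument in the Morrey class, so `D` is bounded by
Calderón–Zygmund near the ball and by the Morrey far field; `A ≤ C`, `C ≤ 2C²`, `E ≤ 3C`;
all balls by the scaling / translation / past-shift invariance of 𝒦_C). Its blow-downs
`c u(c²t, c x)`, `c → ∞`, obey the same rate and blow up in `L^∞(Q(0,R))` for every `R`, so the
engine `slab_typeI_compactness` (A–B Lemma 2.2 + Prop 2.3 on the slab) produces an
ORIGIN-SINGULAR suitable weak slab solution with `𝐈 < ∞` and the rate a.e.
(`blowDown_of_slabEngine`), made pointwise by `exists_rate_profile_repr`. [cite: AlbrittonBarker2019, Thm 1.1 and §3] -/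
theorem squeezeCycle_singularProfileOfNontrivial_proof :
    Summit.NavierStokesRegularity.NavierStokesRegularity.Theses.SqueezeCycle.SingularProfileOfNontrivial := by
  intro C u hu hnt
  obtain ⟨h1, h2, h3, h4, h5⟩ := hu
  obtain ⟨ts, hts, xs, hxs⟩ := hnt
  have hK : IsTypeIAncientMild C u := isTypeIAncientMild_of_squeezeClass h1 h2 h3 h4
  have hC0 : 0 ≤ C := hK.nonneg
  obtain ⟨q, hq⟩ := exists_isClassicalNSSolutionOn_Iio_of_isTypeIAncientMild hK
  obtain ⟨hsw, hwg, hI⟩ := squeezeCycle_slabProfile_of_modelClass hK h5 hq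
  -- non-triviality almost everywhere, and the scale-invariant majorant of all zooms
  have hnt' : ¬ (uncurry u =ᵐ[volume.restrict (Iio (0 : ℝ) ×ˢ (univ : Set (EuclideanSpace ℝ (Fin 3))))] 0) :=
    ApexLocalisation.Negative.not_ae_eq_zero_of_continuousOn_slab hK.continuousOn_uncurry hts hxs
  have hF : ∀ c : ℝ, 1 ≤ c → ∀ t : ℝ, t < 0 → ∀ x : EuclideanSpace ℝ (Fin 3),
      ‖c • u (c ^ 2 * t) (c • x)‖ ≤ C / Real.sqrt (-t) := fun c hc t ht x =>
    (h4.nsRescale (by linarith : 0 < c)) t ht x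
  -- blow-down through the engine
  obtain ⟨w, p, H, hsw', hwg', hI', hsing, hae⟩ :=
    ApexLocalisation.Negative.blowDown_of_slabEngine (F := fun z => C / Real.sqrt (-z.1))
      slab_typeI_compactness hsw hwg hI hnt' hF
  have hae' : ∀ᵐ z ∂(volume.restrict (Iio (0 : ℝ) ×ˢ (univ : Set (EuclideanSpace ℝ (Fin 3))))),
      ‖w z.1 z.2‖ ≤ C / Real.sqrt (-z.1) :=
    hae.mono fun z hz => by simpa [Function.uncurry] using hz
  obtain ⟨w', -, k1, k2, k3, k4, k5⟩ := exists_rate_profile_repr hC0 hsw' hwg' hI' hsing hae'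
  exact ⟨w', p, H, k1, k2, k3, k4, k5⟩

end Summit.NavierStokesRegularity.NavierStokesRegularity.Theorems
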